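import Mathlib
import Summits.ResolutionOfSingularities.ResolutionOfSingularities.Theorems.WeightedInvariantLocalWeightedDropNCResRegimeDefs
import Summits.ResolutionOfSingularities.ResolutionOfSingularities.Theorems.WeightedInvariantLocalWeightedDropTOT2E1Decorated
import Summits.ResolutionOfSingularities.ResolutionOfSingularities.Theorems.WeightedInvariantLocalWeightedDropTOT2NearDir
import Summits.ResolutionOfSingularities.ResolutionOfSingularities.Theorems.WeightedInvariantLocalWeightedDropWildMonicWideExit

/-!
# `WeightedInvariant.LocalWeightedDrop`: the TOT₂ line, regime (B) «letters in bad position» — directrix forms across the identity point move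

Crux item stmt-ResolutionOfSingularities-8899 `LocalWeightedDrop` (route `ResolutionOfSingularities/WeightedInvariant`), ENGINE skeleton v33
(res-L1-w43-lead-1 g5, TOT2-LINE v1.3 `L/res-L1-w43-lead-1/g5/TOT2-LINE-v1.3.md` §1–§3), registered regime stub `stub_regimeBad` (deal → res-type-056).
[OURS · L1 W4.3 · chain w43 · seat res-type-056; def-free on `Decoration.IsInv / HCol / IsDirForm / GoodDir / BadDir` (…NCResRegimeDefs, p542423);
the count game is the programme's own; nothing here is a statement of any manuscript; AI-produced, gate-checked, weaker than expert review.]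

WHAT.  The algebra of DIRECTRIX FORMS (`in_c g = λ · (ℓ · v)^c`, `g = f · ∏_{l∈O} x_l`) needed by the loop of regime (B):
* `IsDirForm.dotProduct_eq_zero_of_isInv` — an invariance vector of the form lies in the directrix plane `ℓ = 0` (`c ≥ 1`);
* `IsDirForm.apply_eq_zero_iff` — `ℓ_l = 0` iff the form vanishes at the basis vector `e_l`, i.e. iff the coefficient of `x_l^c` in `g` is `0`;
* ACROSS THE IDENTITY POINT MOVE at an answer `(c, i)` with the SAME head (so the transform is admissible of the same `(o, c)` and its product
  `f′ · ∏_{O′} x` is the slice of the strict transform of the product, `TOT2E1.totalO_transform_eq_slice`): the new degree-`c` form on the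
  hyperplane `s = 0` is the old one on `y_i = 0` (`TOT2Near.initEval_slice_cons_zero`), hence at basis vectors
  `in_c g′ (e_{p⁺}) = in_c g (e_{i.succAbove p})` (`initEval_transform_piSingle_succ`); the answer `c` is an invariance vector of `in_c g`
  (`isInv_answer_of_head_eq`, from res-L1-w43-stub-3's `TOT2Near.initEval_add_smul_eq_of_near`); so for directrix forms `ℓ` of the state and
  `ℓ′` of its transform: `ℓ · c = 0` and `ℓ′_{p⁺} = 0 ↔ ℓ_{i.succAbove p} = 0` (`dirForm_transform_succ_eq_zero_iff`);
* the letters of the transform under the identity family with any weights: `p⁺ ∈ E′ ↔ (i.succAbove p ∈ E ∧ c_{i.succAbove p} = 0)`, `0 ∈ E′`,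
  and `O′ = ∅` when `O = ∅` and the head is kept.
-/

set_option linter.dupNamespace false -- mandated namespace of this single-conjunct summit

noncomputable section

namespace Summit.ResolutionOfSingularities.ResolutionOfSingularities.Theorems

namespace TameFourTupleDrop

open MvPowerSeries Literature.AlgebraicGeometry.Resolution

variable {k : Type} [Field k] {m : ℕ}

/-! ## Basis vectors through `Fin.insertNth` / `Fin.cons` -/

/-- Inserting `0` at slot `i` into the basis vector `e_p` gives the basis vector `e_{i.succAbove p}`. -/
theorem insertNth_zero_piSingle (i : Fin (m + 1)) (p : Fin m) :
    (Fin.insertNth i (0 : k) (Pi.single p 1) : Fin (m + 1) → k) = Pi.single (i.succAbove p) 1 := by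
  funext x
  refine Fin.succAboveCases i ?_ (fun q => ?_) x
  · rw [Fin.insertNth_apply_same, Pi.single_apply, if_neg (Fin.succAbove_ne i p).symm]
  · rw [Fin.insertNth_apply_succAbove, Pi.single_apply, Pi.single_apply]
    simp only [Fin.succAbove_right_inj]

/-- Prepending `0` to the basis vector `e_p` gives the basis vector `e_{p⁺}`. -/
theorem cons_zero_piSingle (p : Fin m) : (Fin.cons (0 : k) (Pi.single p 1) : Fin (m + 1) → k) = Pi.single p.succ 1 := by
  rw [← Fin.insertNth_zero', insertNth_zero_piSingle, Fin.succAbove_zero]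

namespace Decoration

/-! ## Directrix forms: the directrix plane and the support -/

/-- **An invariance vector of the degree-`c` form lies in the directrix plane** (`c ≥ 1`): `λ (ℓ · v)^c = λ (ℓ · 0)^c = 0`. -/
theorem IsDirForm.dotProduct_eq_zero_of_isInv {δ : Decoration k m} {ℓ : Fin (m + 1) → k} (h : δ.IsDirForm ℓ) (hc : δ.c ≠ 0)
    {v : Fin (m + 1) → k} (hv : δ.IsInv v) : dotProduct ℓ v = 0 := by
  obtain ⟨-, la, hla, hcone⟩ := h
  have h0 := hv 0
  rw [zero_add, hcone, hcone, dotProduct_zero, zero_pow hc, mul_zero] at h0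
  exact (pow_eq_zero_iff hc).mp ((mul_eq_zero.mp h0).resolve_left hla)

/-- **The support of a directrix form is read on the degree-`c` form at basis vectors**: `ℓ_l = 0` iff `in_c g (e_l) = 0` (`c ≥ 1`). -/
theorem IsDirForm.apply_eq_zero_iff {δ : Decoration k m} {ℓ : Fin (m + 1) → k} (h : δ.IsDirForm ℓ) (hc : δ.c ≠ 0) (l : Fin (m + 1)) :
    ℓ l = 0 ↔ CobordantChart.initEval (fun _ : Fin (m + 1) => 1) (Pi.single l 1) δ.c (δ.f * ∏ x ∈ δ.O, X x) = 0 := by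
  obtain ⟨-, la, hla, hcone⟩ := h
  rw [hcone, dotProduct_single, mul_one, mul_eq_zero, pow_eq_zero_iff hc, or_iff_right hla]

/-- The coefficient of `x_l^c` in `g = f · ∏_O x_l` vanishes iff `ℓ_l = 0`. -/
theorem IsDirForm.apply_eq_zero_iff_coeff {δ : Decoration k m} {ℓ : Fin (m + 1) → k} (h : δ.IsDirForm ℓ) (hc : δ.c ≠ 0)
    (l : Fin (m + 1)) : ℓ l = 0 ↔ coeff (Finsupp.single l δ.c) (δ.f * ∏ x ∈ δ.O, X x) = 0 := by
  rw [h.apply_eq_zero_iff hc l, WildMonic.initEval_one_piSingle]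

/-! ## Letters and history of the transform under the identity point move -/

/-- The through-going boundary letters of the transform: the new letter `p⁺` is a boundary letter iff the old letter `i.succAbove p` is one
and its component passes through the new point. -/
theorem succ_mem_transform_E_iff (δ : Decoration k m) (w : Fin (m + 1) → ℕ) {c : Fin (m + 1) → k} {i : Fin (m + 1)} (hci : c i ≠ 0)
    (p : Fin m) :
    p.succ ∈ (δ.transform (fun j => (X j : MvPowerSeries (Fin (m + 1)) k)) w c i).E ↔
      i.succAbove p ∈ δ.E ∧ c (i.succAbove p) = 0 := by
  classical
  rw [Decoration.transform_E, Finset.mem_insert, or_iff_right (Fin.succ_ne_zero p)]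
  unfold Decoration.newLetters
  simp only [Finset.mem_image, Finset.mem_filter, TOT2E1.strIdx_X]
  constructor
  · rintro ⟨l, ⟨hlE, hcl⟩, hl⟩
    have hli : l ≠ i := fun h => hci (h ▸ hcl)
    obtain ⟨q, rfl⟩ := Fin.exists_succAbove_eq hli
    rw [RestrictedChartTransport.predAbove_succAbove_succ] at hl
    rw [← Fin.succ_inj.mp hl]
    exact ⟨hlE, hcl⟩
  · rintro ⟨hE, hc0⟩
    exact ⟨i.succAbove p, ⟨hE, hc0⟩, RestrictedChartTransport.predAbove_succAbove_succ i p⟩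

/-- The exceptional letter `0` is a boundary letter of the transform. -/
theorem zero_mem_transform_E (δ : Decoration k m) (Φ : Fin (m + 1) → MvPowerSeries (Fin (m + 1)) k) (w : Fin (m + 1) → ℕ)
    (c : Fin (m + 1) → k) (i : Fin (m + 1)) : (0 : Fin (m + 1)) ∈ (δ.transform Φ w c i).E := by
  rw [Decoration.transform_E]
  exact Finset.mem_insert_self _ _

/-- With empty history and the same head, the transform has empty history. -/
theorem transform_O_eq_empty_of_head_eq {δ : Decoration k m} (hO : δ.O = ∅) {Φ : Fin (m + 1) → MvPowerSeries (Fin (m + 1)) k}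
    {w : Fin (m + 1) → ℕ} {c : Fin (m + 1) → k} {i : Fin (m + 1)} (hhead : (δ.transform Φ w c i).head = δ.head) :
    (δ.transform Φ w c i).O = ∅ := by
  classical
  have ho : (δ.transform Φ w c i).o = δ.o := by
    rw [Decoration.head, Decoration.head, toLex_inj, Prod.mk.injEq] at hhead
    exact hhead.1
  have hnot : ¬ ((sqfRep (δ.strict Φ w c i)).order).toNat < δ.o := by rw [← Decoration.transform_o]; omega
  rw [Decoration.transform_O_of_not_lt _ _ _ _ _ hnot, hO]
  unfold Decoration.newLetters
  simp

/-- The head letter `c` of the transform at the same head. -/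
theorem c_transform_of_head_eq {δ : Decoration k m} {Φ : Fin (m + 1) → MvPowerSeries (Fin (m + 1)) k} {w : Fin (m + 1) → ℕ}
    {c : Fin (m + 1) → k} {i : Fin (m + 1)} (hhead : (δ.transform Φ w c i).head = δ.head) : (δ.transform Φ w c i).c = δ.c := by
  rw [Decoration.head, Decoration.head, toLex_inj, Prod.mk.injEq] at hhead
  exact hhead.2

/-- The order `o` of the transform at the same head. -/
theorem o_transform_of_head_eq {δ : Decoration k m} {Φ : Fin (m + 1) → MvPowerSeries (Fin (m + 1)) k} {w : Fin (m + 1) → ℕ}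
    {c : Fin (m + 1) → k} {i : Fin (m + 1)} (hhead : (δ.transform Φ w c i).head = δ.head) : (δ.transform Φ w c i).o = δ.o := by
  rw [Decoration.head, Decoration.head, toLex_inj, Prod.mk.injEq] at hhead
  exact hhead.1

end Decoration

/-! ## The degree-`c` forms across the identity point move at the same head -/

namespace NCResBad

open TOT2E1

variable {b b' : MvPowerSeries (Fin (m + 1)) k} {δ : Decoration k m} {c : Fin (m + 1) → k} {i : Fin (m + 1)}

/-- **THE NEW FORM ON `s = 0` IS THE OLD FORM ON `y_i = 0`** (same head): `in_c (f′·∏_{O′} x)(0, v′) = in_c (f·∏_O x)(insertNth i 0 v′)`. -/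
theorem initEval_transform_cons_zero (hadm : Admissible b δ) (hci : c i ≠ 0)
    (hhead : (δ.transform (fun j => (X j : MvPowerSeries (Fin (m + 1)) k)) (fun _ => 1) c i).head = δ.head) (v' : Fin m → k) :
    CobordantChart.initEval (fun _ : Fin (m + 1) => 1) (Fin.cons (0 : k) v') δ.c
        ((δ.transform (fun j => (X j : MvPowerSeries (Fin (m + 1)) k)) (fun _ => 1) c i).f *
          ∏ l ∈ (δ.transform (fun j => (X j : MvPowerSeries (Fin (m + 1)) k)) (fun _ => 1) c i).O, X l) =
      CobordantChart.initEval (fun _ : Fin (m + 1) => 1) (Fin.insertNth i (0 : k) v') δ.c (δ.f * ∏ l ∈ δ.O, X l) := by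
  rw [totalO_transform_eq_slice hadm hci hhead]
  exact TOT2Near.initEval_slice_cons_zero _ c i (chart_totalO_eq hadm c) v'

/-- The same at basis vectors: `in_c g′ (e_{p⁺}) = in_c g (e_{i.succAbove p})`, with the transform's own head letter `c′ = c`. -/
theorem initEval_transform_piSingle_succ (hadm : Admissible b δ) (hci : c i ≠ 0)
    (hhead : (δ.transform (fun j => (X j : MvPowerSeries (Fin (m + 1)) k)) (fun _ => 1) c i).head = δ.head) (p : Fin m) :
    CobordantChart.initEval (fun _ : Fin (m + 1) => 1) (Pi.single p.succ 1)
        (δ.transform (fun j => (X j : MvPowerSeries (Fin (m + 1)) k)) (fun _ => 1) c i).c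
        ((δ.transform (fun j => (X j : MvPowerSeries (Fin (m + 1)) k)) (fun _ => 1) c i).f *
          ∏ l ∈ (δ.transform (fun j => (X j : MvPowerSeries (Fin (m + 1)) k)) (fun _ => 1) c i).O, X l) =
      CobordantChart.initEval (fun _ : Fin (m + 1) => 1) (Pi.single (i.succAbove p) 1) δ.c (δ.f * ∏ l ∈ δ.O, X l) := by
  rw [Decoration.c_transform_of_head_eq hhead, ← cons_zero_piSingle, ← insertNth_zero_piSingle]
  exact initEval_transform_cons_zero hadm hci hhead _

/-- **A SAME-HEAD ANSWER IS AN INVARIANCE VECTOR** of the degree-`c` form (res-L1-w43-stub-3's near-point theorem read on the product). -/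
theorem isInv_answer_of_head_eq (hadm : Admissible b δ) (hci : c i ≠ 0)
    (hadm' : Admissible b' (δ.transform (fun j => (X j : MvPowerSeries (Fin (m + 1)) k)) (fun _ => 1) c i))
    (hhead : (δ.transform (fun j => (X j : MvPowerSeries (Fin (m + 1)) k)) (fun _ => 1) c i).head = δ.head) : δ.IsInv c := by
  intro v
  have hnear : ((δ.c : ℕ) : ℕ∞) ≤ (TupleGame.slice i (satPart (δ.fChart (fun j => (X j : MvPowerSeries (Fin (m + 1)) k)) (fun _ => 1) c) *
      ∏ l ∈ δ.O, (C (c l) + X l.succ))).order := by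
    rw [← totalO_transform_eq_slice hadm hci hhead, Decoration.order_totalO hadm', Decoration.c_transform_of_head_eq hhead]
  have h := TOT2Near.initEval_add_smul_eq_of_near _ c i hci (chart_totalO_eq hadm c) hnear 1 v
  rwa [one_smul] at h

/-- **THE ANSWER LIES IN THE DIRECTRIX PLANE**: at a same-head answer `c` of the identity point move, `ℓ · c = 0` for every directrix form `ℓ`
of the state (`o ≥ 1`). -/
theorem dotProduct_answer_eq_zero (hadm : Admissible b δ) (ho : 1 ≤ δ.o) (hci : c i ≠ 0)
    (hadm' : Admissible b' (δ.transform (fun j => (X j : MvPowerSeries (Fin (m + 1)) k)) (fun _ => 1) c i))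
    (hhead : (δ.transform (fun j => (X j : MvPowerSeries (Fin (m + 1)) k)) (fun _ => 1) c i).head = δ.head)
    {ℓ : Fin (m + 1) → k} (hℓ : δ.IsDirForm ℓ) : dotProduct ℓ c = 0 :=
  hℓ.dotProduct_eq_zero_of_isInv (by rw [Decoration.c]; omega) (isInv_answer_of_head_eq hadm hci hadm' hhead)

/-- **THE SUPPORTS OF THE DIRECTRIX FORMS ACROSS THE MOVE**: for directrix forms `ℓ` of the state and `ℓ′` of its same-head transform,
`ℓ′_{p⁺} = 0 ↔ ℓ_{i.succAbove p} = 0` (`o ≥ 1`). -/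
theorem dirForm_transform_succ_eq_zero_iff (hadm : Admissible b δ) (ho : 1 ≤ δ.o) (hci : c i ≠ 0)
    (hhead : (δ.transform (fun j => (X j : MvPowerSeries (Fin (m + 1)) k)) (fun _ => 1) c i).head = δ.head)
    {ℓ ℓ' : Fin (m + 1) → k} (hℓ : δ.IsDirForm ℓ)
    (hℓ' : (δ.transform (fun j => (X j : MvPowerSeries (Fin (m + 1)) k)) (fun _ => 1) c i).IsDirForm ℓ') (p : Fin m) :
    ℓ' p.succ = 0 ↔ ℓ (i.succAbove p) = 0 := by
  have hc : δ.c ≠ 0 := by rw [Decoration.c]; omega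
  have hc' : (δ.transform (fun j => (X j : MvPowerSeries (Fin (m + 1)) k)) (fun _ => 1) c i).c ≠ 0 := by
    rw [Decoration.c_transform_of_head_eq hhead]; exact hc
  rw [hℓ'.apply_eq_zero_iff hc', hℓ.apply_eq_zero_iff hc, initEval_transform_piSingle_succ hadm hci hhead]

end NCResBad

end TameFourTupleDrop

end Summit.ResolutionOfSingularities.ResolutionOfSingularities.Theorems

end
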